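import Mathlib.LinearAlgebra.Matrix.GeneralLinearGroup.Defs
import Mathlib.LinearAlgebra.Matrix.Notation
import Mathlib.Data.Matrix.Basis
import Mathlib.Data.ZMod.Basic
import Mathlib.Tactic.FinCases
import Mathlib.Tactic.NormNum
import HarnessLib

/-!
# X11b at `p = 3` (team N8/O2), LINE-K sub-target E-K8 · IMG3-GEN (1/3): a subgroup of
# `GL₂(ℤ/p^{k+1})` with full image mod `p` SPANS the matrix ring `M₂(ℤ/p^{k+1})`
# (cell `b2b-bsdres`, team `x11b3`, seat p2)

HONEST FRAMING (verbatim, cell `b2b-bsdres`, run/shared/lean/b2b/bsd-rank1-residual/): the goal of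
the cell is to DELETE the COMBINATION-SHAPED residual classes for ALL analytic-rank `≤ 1` curves
over `ℚ` — "full BSD formula for every rank `≤ 1` curve in class `C`" assembled STRICTLY from
published theorems — so that the rank-`≤ 1` remainder becomes exactly the CONSTRUCTION-SHAPED
classes, which are TYPED (missing-input Props), NOT attempted; this is not "finishing BSD".
Research route (team N8/O2: STEP L at `3 ‖ N`, LINE K); PURE ALGEBRA; nothing booked; no label
touched; X11b@3 stays OPEN (RESIDUAL-MAP §I O2). THEOREMS ONLY; no definition; no named fact;
no `sorry`.

## Why (LINE-K.md ⟦r2 05:57Z⟧ block 3, step U2 = McCallum 1991 §3 (2), surjectivity half;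
## sub-target E-K8 · IMG3-GEN, OWNERS.md claim ⟦x11b3-p2 GEN 2, 06:02Z⟧)

McCallum's structure theorem for `Ш(E/K)[p^∞]` (tree fact
`Literature/…/KolyvaginShaStructure.lean`, consumer `Three/McCallumCertificate.lean`) is printed
under "`Gal(ℚ(E_p)/ℚ) = GL₂(ℤ/p)`" and uses, at level `p^M`, that for `L = K(E_{p^M})` and every
finite `C ≤ H¹(K, E_{p^M})` one has `Gal(L_C/L) ≅ Hom(C, E_{p^M})` equivariantly. Besides
`H¹(L/K, E_{p^M}) = 0` (U1 — Sah, in the tree: `Three/ImageSah`, `Three/TorsionNegOneLift`,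
`Three/GaloisImageNegOne`) the proof needs that the image `Γ_M = ρ_{E,p^M}(G_K) ≤ GL₂(ℤ/p^M)`
GENERATES the matrix ring `M₂(ℤ/p^M)`, so that `Γ_M`-stable subgroups of
`Hom(C, E_{p^M}) ≅ Hom(C, ℤ/p^M)^{⊕ 2}` are `M₂`-submodules, hence of the form `Y ⊕ Y` (Morita),
and then `Y = Hom(C, ℤ/p^M)` by duality of finite groups. At `p = 3` the usual shortcut
"`p ∤ #Γ`" is dead (`3 ∣ #GL₂(𝔽₃) = 48`); none is needed: everything follows from the surjectivity
of the MOD-`p` representation ALONE (no `3`-adic tower hypothesis), for every prime `p` and every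
level `p^{k+1}`. The three files of E-K8: `Three/ImageSpan` (the span), `Three/MoritaDuality`
(Morita + duality), `Three/ImageGenerates` (assembly).

## What is proved here (elementary; every prime `p`, every `k`)

* `ImageSpan.submodule_eq_top_of_single_mem` — a submodule of `Matrix m n R` containing every
  `E_{ij}` is everything; `ImageSpan.single_mem_of_four_mem` — the four `2 × 2` matrix units are
  `ℤ`-combinations of `1`, `T = [[1,1],[0,1]]`, `T' = [[1,0],[1,1]]`, `S = [[1,1],[1,0]]`.
* `ImageSpan.span_range_generalLinearGroup_eq_top` — **`GL₂(R)` spans `M₂(R)`** over ANY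
  commutative ring (`T, T', S` are invertible over `ℤ`); in particular `GL₂(𝔽_p)` spans `M₂(𝔽_p)`
  at EVERY prime, `p = 2, 3` included (no Burnside, no `p ∤ #G`).
* `ImageSpan.eq_top_of_forall_exists_eq_add_smul` — nilpotent Nakayama by hand: `a^k = 0` and
  `∀ x, x ∈ N + a•M` ⇒ `N = M`.
* `ImageSpan.exists_eq_prime_mul_of_cast_eq_zero` / `…_smul_of_map_eq_zero` — the kernel of
  `ℤ/p^{k+1} → 𝔽_p` (resp. on matrices) is `p · (−)`.
* `ImageSpan.span_eq_top_of_forall_exists_map_eq` — **a set `S ⊆ M₂(ℤ/p^{k+1})` whose invertible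
  members reduce ONTO `GL₂(𝔽_p)` spans `M₂(ℤ/p^{k+1})`**; subgroup form
  `ImageSpan.span_eq_top_of_subgroup` with the hypothesis LITERALLY in the shape used by
  `GaloisRepresentations.Serre1968.generalLinearGroup_eq_top_of_map_surjective`
  (`SerreSL2Lifting.lean`, which needs `p ≥ 5` to conclude `Γ = GL₂`) and produced from
  `W.HasSurjectiveModNGaloisRep p` + a frame `E[p^{k+1}] ≃+ (ℤ/p^{k+1})²` by
  `EllipticCurves.exists_map_eq_of_hasSurjectiveModNGaloisRep` (`BSDSelmerPConverseSerreProofs`):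
  `∀ t : GL (Fin 2) (ZMod p), ∃ g ∈ Γ, GeneralLinearGroup.map (ZMod.castHom _ (ZMod p)) g = t`.

What this file is NOT: no Galois cohomology, no elliptic curve, no claim about any class;
nothing booked. Companions: `Three/MoritaDuality.lean` (2/3), `Three/ImageGenerates.lean` (3/3).

References: W. G. McCallum, *Kolyvagin's work on Shafarevich–Tate groups*, in L-functions and
Arithmetic (Durham 1989), LMS LNS 153 (1991), §3 [McCallum1991]; J.-P. Serre, *Propriétés
galoisiennes des points d'ordre fini des courbes elliptiques*, Invent. Math. 15 (1972) §IV
[Serre1972]; S. Lang, *Algebra*, XVII §1 (modules over matrix rings) [Lang2002];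
J. S. Milne, *Arithmetic Duality Theorems*, I §0 (0.19) [MilneADT2006]; team files
`cells/x11b3/LINE-K.md` block 3 (U2, E-K8), `cells/x11b3/PLAN.md` §2.
-/

namespace Summit.BirchSwinnertonDyer.Rank1Residual.X11b.Three

open Matrix

/-! ## §1–§2 Spanning the matrix ring -/

namespace ImageSpan

section AnyRing

variable {R : Type*}

/-- A submodule of `m × n` matrices containing every elementary matrix `E_{ij}` is everything
(`x = Σ_{ij} x_{ij} • E_{ij}`). [folklore] -/
theorem submodule_eq_top_of_single_mem [Semiring R] {m n : Type*} [Fintype m] [Fintype n]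
    [DecidableEq m] [DecidableEq n] {N : Submodule R (Matrix m n R)}
    (h : ∀ i j, Matrix.single i j (1 : R) ∈ N) : N = ⊤ := by
  rw [eq_top_iff]
  rintro x -
  rw [Matrix.matrix_eq_sum_single x]
  refine Submodule.sum_mem _ fun i _ => Submodule.sum_mem _ fun j _ => ?_
  have hx : Matrix.single i j (x i j) = x i j • Matrix.single i j (1 : R) := by
    rw [Matrix.smul_single, smul_eq_mul, mul_one]
  rw [hx]
  exact N.smul_mem _ (h i j)

/-- The four `2 × 2` elementary matrices are `ℤ`-combinations of `1`, `T = [[1,1],[0,1]]`,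
`T' = [[1,0],[1,1]]`, `S = [[1,1],[1,0]]` — `E₀₁ = T − 1`, `E₁₀ = T' − 1`,
`E₁₁ = (T' − 1) − (S − T)`, `E₀₀ = 1 − E₁₁` — so a submodule of `M₂(R)` containing the four
contains every `E_{ij}`. [folklore] -/
theorem single_mem_of_four_mem [Ring R] {N : Submodule R (Matrix (Fin 2) (Fin 2) R)}
    (h1 : (1 : Matrix (Fin 2) (Fin 2) R) ∈ N) (hT : !![1, 1; 0, 1] ∈ N)
    (hT' : !![1, 0; 1, 1] ∈ N) (hS : !![1, 1; 1, 0] ∈ N) (i j : Fin 2) :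
    Matrix.single i j (1 : R) ∈ N := by
  have e01 : Matrix.single 0 1 (1 : R) = !![1, 1; 0, 1] - 1 := by
    ext a b; fin_cases a <;> fin_cases b <;> simp [Matrix.one_fin_two]
  have e10 : Matrix.single 1 0 (1 : R) = !![1, 0; 1, 1] - 1 := by
    ext a b; fin_cases a <;> fin_cases b <;> simp [Matrix.one_fin_two]
  have e11 : Matrix.single 1 1 (1 : R) =
      (!![1, 0; 1, 1] - 1) - (!![1, 1; 1, 0] - !![1, 1; 0, 1]) := by
    ext a b; fin_cases a <;> fin_cases b <;> simp [Matrix.one_fin_two]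
  have e00 : Matrix.single 0 0 (1 : R) =
      1 - ((!![1, 0; 1, 1] - 1) - (!![1, 1; 1, 0] - !![1, 1; 0, 1])) := by
    ext a b; fin_cases a <;> fin_cases b <;> simp [Matrix.one_fin_two]
  have h00 : Matrix.single 0 0 (1 : R) ∈ N := by
    rw [e00]; exact N.sub_mem h1 (N.sub_mem (N.sub_mem hT' h1) (N.sub_mem hS hT))
  have h01 : Matrix.single 0 1 (1 : R) ∈ N := by rw [e01]; exact N.sub_mem hT h1
  have h10 : Matrix.single 1 0 (1 : R) ∈ N := by rw [e10]; exact N.sub_mem hT' h1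
  have h11 : Matrix.single 1 1 (1 : R) ∈ N := by
    rw [e11]; exact N.sub_mem (N.sub_mem hT' h1) (N.sub_mem hS hT)
  fin_cases i <;> fin_cases j
  · exact h00
  · exact h01
  · exact h10
  · exact h11

/-- **`GL₂(R)` spans `M₂(R)`** (as an `R`-module) for every commutative ring `R`: the matrices
`1`, `T = [[1,1],[0,1]]`, `T' = [[1,0],[1,1]]`, `S = [[1,1],[1,0]]` are invertible over `ℤ`
(inverses `[[1,−1],[0,1]]`, `[[1,0],[−1,1]]`, `[[0,1],[1,−1]]`) and combine to every `E_{ij}`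
(`single_mem_of_four_mem`). In particular `GL₂(𝔽_p)` spans `M₂(𝔽_p)` for EVERY prime `p`
(Burnside's theorem is not needed). [folklore] -/
theorem span_range_generalLinearGroup_eq_top [CommRing R] :
    Submodule.span R (Set.range ((↑) : GL (Fin 2) R → Matrix (Fin 2) (Fin 2) R)) = ⊤ := by
  apply submodule_eq_top_of_single_mem
  apply single_mem_of_four_mem
  · exact Submodule.subset_span ⟨1, rfl⟩
  · refine Submodule.subset_span ⟨⟨!![1, 1; 0, 1], !![1, -1; 0, 1], ?_, ?_⟩, rfl⟩ <;>
      simp [Matrix.one_fin_two]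
  · refine Submodule.subset_span ⟨⟨!![1, 0; 1, 1], !![1, 0; -1, 1], ?_, ?_⟩, rfl⟩ <;>
      simp [Matrix.one_fin_two]
  · refine Submodule.subset_span ⟨⟨!![1, 1; 1, 0], !![0, 1; 1, -1], ?_, ?_⟩, rfl⟩ <;>
      simp [Matrix.one_fin_two]

/-- **Nilpotent Nakayama, by hand.** If `a^k = 0` in `R` and every `x ∈ M` is `y + a • z` with
`y ∈ N`, then `N = M` (iterate: `x = (y₀ + a y₁ + ⋯ + a^{k-1} y_{k-1}) + a^k z = Σ aⁱ yᵢ ∈ N`).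
[folklore] -/
theorem eq_top_of_forall_exists_eq_add_smul [Ring R] {M : Type*} [AddCommGroup M] [Module R M]
    (N : Submodule R M) {a : R} {k : ℕ} (ha : a ^ k = 0)
    (h : ∀ x : M, ∃ y ∈ N, ∃ z : M, x = y + a • z) : N = ⊤ := by
  have key : ∀ j : ℕ, ∀ x : M, ∃ y ∈ N, ∃ z : M, x = y + a ^ j • z := by
    intro j
    induction j with
    | zero => exact fun x => ⟨0, N.zero_mem, x, by simp⟩
    | succ j ih =>
      intro x
      obtain ⟨y, hy, z, rfl⟩ := ih x
      obtain ⟨y', hy', z', rfl⟩ := h z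
      exact ⟨y + a ^ j • y', N.add_mem hy (N.smul_mem _ hy'), z',
        by rw [smul_add, ← mul_smul, ← pow_succ, add_assoc]⟩
  rw [eq_top_iff]
  rintro x -
  obtain ⟨y, hy, z, rfl⟩ := key k x
  rw [ha, zero_smul, add_zero]
  exact hy

end AnyRing

/-! ### §2 Reduction modulo `p`: the kernel of `ℤ/p^{k+1} → 𝔽_p` is `p·(ℤ/p^{k+1})`, and the span -/

section Lift

variable {p : ℕ} [Fact p.Prime] {k : ℕ}

/-- An element of `ℤ/p^{k+1}` reducing to `0` mod `p` is a multiple of `p`. [folklore] -/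
theorem exists_eq_prime_mul_of_cast_eq_zero (x : ZMod (p ^ (k + 1)))
    (hx : ZMod.castHom (dvd_pow_self p k.succ_ne_zero) (ZMod p) x = 0) :
    ∃ z : ZMod (p ^ (k + 1)), x = (p : ZMod (p ^ (k + 1))) * z := by
  have hp : p.Prime := Fact.out
  haveI : NeZero (p ^ (k + 1)) := ⟨pow_ne_zero _ hp.ne_zero⟩
  rw [ZMod.castHom_apply, ZMod.cast_eq_val, ZMod.natCast_eq_zero_iff] at hx
  obtain ⟨c, hc⟩ := hx
  refine ⟨(c : ZMod (p ^ (k + 1))), ?_⟩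
  rw [← ZMod.natCast_zmod_val x, hc, Nat.cast_mul]

/-- A matrix over `ℤ/p^{k+1}` reducing to `0` mod `p` is `p • Z`. [folklore] -/
theorem exists_eq_prime_smul_of_map_eq_zero {m n : Type*}
    (X : Matrix m n (ZMod (p ^ (k + 1))))
    (hX : X.map (ZMod.castHom (dvd_pow_self p k.succ_ne_zero) (ZMod p)) = 0) :
    ∃ Z : Matrix m n (ZMod (p ^ (k + 1))), X = (p : ZMod (p ^ (k + 1))) • Z := by
  have h : ∀ i j, ∃ z : ZMod (p ^ (k + 1)), X i j = (p : ZMod (p ^ (k + 1))) * z :=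
    fun i j => exists_eq_prime_mul_of_cast_eq_zero (X i j) (by
      have := congrFun (congrFun hX i) j
      simpa only [Matrix.map_apply, Matrix.zero_apply] using this)
  choose Z hZ using h
  exact ⟨Matrix.of Z, by ext i j; rw [Matrix.smul_apply, Matrix.of_apply, smul_eq_mul]; exact hZ i j⟩

omit [Fact p.Prime] in
/-- `p^{k+1} = 0` in `ℤ/p^{k+1}`. [folklore] -/
theorem natCast_prime_pow_succ_eq_zero : ((p : ZMod (p ^ (k + 1)))) ^ (k + 1) = 0 := by
  rw [← Nat.cast_pow, ZMod.natCast_self]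

/-- **A set of matrices over `ℤ/p^{k+1}` whose invertible members reduce ONTO `GL₂(𝔽_p)` spans
`M₂(ℤ/p^{k+1})`.** Proof: the reductions mod `p` of `span S` form an `𝔽_p`-subspace containing
`GL₂(𝔽_p)`, hence everything (§1, `span_range_generalLinearGroup_eq_top`); so every `X` is
`Y + p • Z` with `Y ∈ span S` (`exists_eq_prime_smul_of_map_eq_zero`), and the nilpotent Nakayama
iteration (`eq_top_of_forall_exists_eq_add_smul`, `p^{k+1} = 0`) concludes. EVERY prime `p`
(no `p ≥ 5`, no `p ∤ #Γ`). [folklore] -/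
theorem span_eq_top_of_forall_exists_map_eq
    (S : Set (Matrix (Fin 2) (Fin 2) (ZMod (p ^ (k + 1)))))
    (hS : ∀ t : GL (Fin 2) (ZMod p), ∃ g : GL (Fin 2) (ZMod (p ^ (k + 1))),
      (g : Matrix (Fin 2) (Fin 2) (ZMod (p ^ (k + 1)))) ∈ S ∧
        Matrix.GeneralLinearGroup.map (ZMod.castHom (dvd_pow_self p k.succ_ne_zero) (ZMod p)) g
          = t) :
    Submodule.span (ZMod (p ^ (k + 1))) S = ⊤ := by
  -- the reductions of `span S` form a subspace `N'` of `M₂(𝔽_p)`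
  let π := ZMod.castHom (dvd_pow_self p k.succ_ne_zero) (ZMod p)
  let N := Submodule.span (ZMod (p ^ (k + 1))) S
  let N' : Submodule (ZMod p) (Matrix (Fin 2) (Fin 2) (ZMod p)) :=
    { carrier := {A | ∃ Y ∈ N, Y.map π = A}
      add_mem' := by
        rintro A B ⟨Y, hY, rfl⟩ ⟨Y', hY', rfl⟩
        exact ⟨Y + Y', N.add_mem hY hY', Matrix.map_add π (map_add π) Y Y'⟩
      zero_mem' := ⟨0, N.zero_mem, Matrix.map_zero π (map_zero π)⟩
      smul_mem' := by
        rintro c A ⟨Y, hY, rfl⟩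
        obtain ⟨c', rfl⟩ := ZMod.castHom_surjective (dvd_pow_self p k.succ_ne_zero) c
        refine ⟨c' • Y, N.smul_mem c' hY, ?_⟩
        ext i j
        simp only [Matrix.map_apply, Matrix.smul_apply, smul_eq_mul, map_mul]
        rfl }
  -- `N'` contains `GL₂(𝔽_p)`, hence is everything
  have hN' : Submodule.span (ZMod p)
      (Set.range ((↑) : GL (Fin 2) (ZMod p) → Matrix (Fin 2) (Fin 2) (ZMod p))) ≤ N' := by
    rw [Submodule.span_le]
    rintro _ ⟨t, rfl⟩
    obtain ⟨g, hgS, hgt⟩ := hS t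
    refine ⟨(g : Matrix (Fin 2) (Fin 2) (ZMod (p ^ (k + 1)))), Submodule.subset_span hgS, ?_⟩
    ext i j
    rw [Matrix.map_apply, ← hgt, Matrix.GeneralLinearGroup.map_apply]
  rw [span_range_generalLinearGroup_eq_top, top_le_iff] at hN'
  -- every `X` is `Y + p • Z` with `Y ∈ span S`
  have H1 : ∀ X : Matrix (Fin 2) (Fin 2) (ZMod (p ^ (k + 1))),
      ∃ Y ∈ N, ∃ Z, X = Y + (p : ZMod (p ^ (k + 1))) • Z := by
    intro X
    obtain ⟨Y, hY, hYX⟩ : X.map π ∈ N' := by rw [hN']; exact Submodule.mem_top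
    obtain ⟨Z, hZ⟩ := exists_eq_prime_smul_of_map_eq_zero (X - Y)
      (by rw [Matrix.map_sub π (map_sub π), hYX, sub_self])
    exact ⟨Y, hY, Z, by rw [← hZ, add_sub_cancel]⟩
  exact eq_top_of_forall_exists_eq_add_smul N natCast_prime_pow_succ_eq_zero H1

/-- **Subgroup form (the shape produced by the tree's framed-representation glue).** If
`Γ ≤ GL₂(ℤ/p^{k+1})` maps ONTO `GL₂(𝔽_p)` under reduction — hypothesis written exactly as in
`GaloisRepresentations.Serre1968.generalLinearGroup_eq_top_of_map_surjective` and as delivered by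
`EllipticCurves.exists_map_eq_of_hasSurjectiveModNGaloisRep` from `W.HasSurjectiveModNGaloisRep p`
— then the underlying matrices of `Γ` span `M₂(ℤ/p^{k+1})` over `ℤ/p^{k+1}`: "`Γ` generates the
matrix ring". EVERY prime `p` (at `p ≥ 5` Serre's lemma gives the stronger `Γ = GL₂`; at `p = 2, 3`
only the span statement survives, and it is what McCallum §3 (2) uses). [folklore] -/
theorem span_eq_top_of_subgroup (Γ : Subgroup (GL (Fin 2) (ZMod (p ^ (k + 1)))))
    (hΓ : ∀ t : GL (Fin 2) (ZMod p), ∃ g ∈ Γ,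
      Matrix.GeneralLinearGroup.map (ZMod.castHom (dvd_pow_self p k.succ_ne_zero) (ZMod p)) g
        = t) :
    Submodule.span (ZMod (p ^ (k + 1)))
      ((fun g : GL (Fin 2) (ZMod (p ^ (k + 1))) => (g : Matrix (Fin 2) (Fin 2) (ZMod (p ^ (k + 1)))))
        '' (Γ : Set (GL (Fin 2) (ZMod (p ^ (k + 1)))))) = ⊤ := by
  apply span_eq_top_of_forall_exists_map_eq
  intro t
  obtain ⟨g, hg, hgt⟩ := hΓ t
  exact ⟨g, ⟨g, hg, rfl⟩, hgt⟩

end Lift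

end ImageSpan

end Summit.BirchSwinnertonDyer.Rank1Residual.X11b.Three
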